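import Literature.NumberTheory.LFunctions.VinogradovKorobovLargeHeightMain
import Literature.NumberTheory.LFunctions.VinogradovKorobovIntermediate
import Literature.NumberTheory.LFunctions.ZetaOneLineBounds
import HarnessLib

/-!
# Theorem 1.4 of Mossinghoff–Trudgian–Yang from Lemma 6.1 alone: the descent run on Titchmarsh's explicit region

Topic `Literature/NumberTheory/LFunctions`. Part of the decomposition of the named facts
`Literature.NumberTheory.LFunctions.zero_bound_large_height_mossinghoff_trudgian_yang` (§5 of
Mossinghoff–Trudgian–Yang, *Res. Number Theory* 10 (2024) = arXiv:2212.06867: `Z(β, t) ≥ M₁ =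
0.048976` for every zero of height `t ≥ T₀ = exp 52238`) and
`Literature.NumberTheory.LFunctions.zero_free_region_vinogradov_korobov` (rh.S10 = Theorem 1.1 there);
architecture in `VinogradovKorobov.lean`, arXiv numbering throughout. Everything here is PROVED.

## What this file removes from the trust base of the §5 bound

`VinogradovKorobovIntermediate.lean` proves Theorem 1.4 of the source for `|t| ≥ exp 1001` from the
zero inequality Lemma 6.1 (`zero_inequality_intermediate_mossinghoff_trudgian_yang`) **and Theorem 1.3**
(`zero_free_region_mossinghoff_trudgian_yang`, the explicit classical region with `R = 5.558691`),
and `RHWave0VinogradovKorobovProofs.lean` accordingly closes the §5 bound as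
`zero_bound_large_height_of_inputs hF hC hZ47 hZ6` with `hC` = Theorem 1.3. But Theorem 1.3 is the one
leaf below rh.S10 that is not analysis: its printed proof (§9 of the source) rests on the
Platt–Trudgian verification of RH to height `3·10¹²`, for which no kernel-checkable certificate is
feasible (`ExplicitZeroFreeRegionInputs.lean`). In the §6 argument, however, Theorem 1.3 is used at
exactly one point: the *a priori* bound `V(β, t) ≥ 0.5882` (`VK.mtyV_ge`) that makes the descending
chains of counterexamples of `VK.exists_window_minimal_zero₆` finite (its two other uses,
in `VK.zetaZeroFreeRect₆` and `VK.terminal₆`, only need `V > 0`, i.e. `β < 1`). Finiteness of the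
chains needs far less than Theorem 1.3: **any explicit zero-free region does**, because along a chain
`V` decays geometrically while the height grows at most geometrically (`t' ≤ 40t + 1`), so that a
lower bound for `V` decaying like any power of `log t` is eventually violated. The tree PROVES such a
region — Titchmarsh's (3.6.5), `ζ(s) ≠ 0` for `|t| ≥ 4`, `σ ≥ 1 − 1/(2K log⁹|t|)`,
`K = 1134·16·336⁴` (`ZetaOneLine.riemannZeta₁_ne_zero_of_re_ge`, `ZetaOneLineBounds.lean`) — whence
`V(β, t) ≥ κ/(log t)⁸`, `κ = (27/164)/(0.1007 K)` (`VK.mtyV_lower_explicit`).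

Running the descent of `VinogradovKorobovIntermediate.lean` on this bound (`VK.exists_window_minimal_zero₆'`:
from a counterexample at height `t₀ ≥ exp 1001` take `N = ⌊t₀ − exp 1000⌋` steps; heights stay in
`[t₀ − N, 41^N t₀] ⊂ [exp 1000, ∞)`, and `(1 + 10⁻⁵)^N κ > (log t₀ + 4N)⁸` since `N ≥ t₀/2` and
`t₀ ≥ exp 1001`, `VK.chain_bound₆'`) and re-running the terminal step verbatim with positivity in
place of `VK.mtyV_ge` (`VK.zetaZeroFreeRect₆'`, `VK.terminal₆'`) gives:

* `Literature.NumberTheory.LFunctions.VK.one_le_mtyV'`,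
  `Literature.NumberTheory.LFunctions.zero_free_region_intermediate_of_zero_inequality'` — **Theorem 1.4
  for `|t| ≥ exp 1001` from Lemma 6.1 alone**;
* `Literature.NumberTheory.LFunctions.VK.intermediateRegionFrom_exp_7000_of_zero_inequality'` — hence
  `IntermediateRegionFrom (exp 7000)` from Lemma 6.1 alone;
* `Literature.NumberTheory.LFunctions.zero_bound_large_height_of_inputs'` — **the §5 bound
  `zero_bound_large_height_mossinghoff_trudgian_yang` from (3.1) ∧ Lemma 4.7 ∧ Lemma 6.1** (three
  analytic named facts; Theorem 1.3 and with it the RH verification drop out of its closure).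

For rh.S10 itself Theorem 1.3 is still needed, but only through the crossover `log|t| ≤ 7000` of the
assembly `zero_free_region_vinogradov_korobov_of_parts'` (feed it
`VK.intermediateRegionFrom_exp_7000_of_zero_inequality'` and `zero_bound_large_height_of_inputs'`;
the resulting statement coincides with `zero_free_region_vinogradov_korobov_of_inputs` of
`RHWave0VinogradovKorobovProofs.lean` and is not restated).

## References

* M. J. Mossinghoff, T. S. Trudgian, A. Yang, *Explicit zero-free regions for the Riemann
  zeta-function*, Res. Number Theory 10 (2024), no. 11 = arXiv:2212.06867: Theorem 1.4, §6 (Lemma 6.1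
  and the proof of Theorem 1.4), §5 (proof of Theorem 1.1 for `t ≥ T₀`)
  (`MossinghoffTrudgianYangRNT2024`).
* E. C. Titchmarsh, *The Theory of the Riemann Zeta-Function*, 2nd ed. (1986), §3.6, (3.6.4)–(3.6.5)
  (`Titchmarsh1986`) — the explicit region used for the a priori bound.
-/

noncomputable section

open Real Complex

namespace Literature.NumberTheory.LFunctions

namespace VK

/-! ### `V > 0` and the explicit a priori lower bound for `V` -/

/-- `V(β, t) > 0` for a zero `β + it` with `t ≥ exp 999` (`β < 1` as `ζ ≠ 0` on `Re s ≥ 1`).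
[folklore] -/
theorem mtyV_pos {β t : ℝ} (ht : Real.exp 999 ≤ t) (hz : riemannZeta (β + t * I) = 0) :
    0 < mtyV β t := by
  have h1 := one_sub_pos_of_riemannZeta_eq_zero hz
  have h2 := mtyJ_add_ge' ht
  have h3 := mtyNum_pos ht
  unfold mtyV
  exact div_pos (mul_pos h1 (by linarith)) h3

/-- **Titchmarsh's explicit region at a zero**: a zero `β + it` of `ζ` with `t ≥ exp 999` has
`1 − β > 1/(2K log⁹ t)`, `K = 1134·16·336⁴` (the tree's `ZetaOneLine.riemannZeta₁_ne_zero_of_re_ge`,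
Titchmarsh (3.6.4)–(3.6.5)). [cite: Titchmarsh1986, §3.6 eq. (3.6.4)–(3.6.5)] -/
theorem one_sub_gt_titchmarsh {β t : ℝ} (ht : Real.exp 999 ≤ t) (hz : riemannZeta (β + t * I) = 0) :
    1 / (2 * (1134 * 16 * 336 ^ 4) * Real.log t ^ 9) < 1 - β := by
  have ht0 : 0 < t := (Real.exp_pos _).trans_le ht
  have ht4 : (4 : ℝ) ≤ t := le_trans (by linarith [Real.add_one_le_exp (999 : ℝ)]) ht
  have hβ1 := one_sub_pos_of_riemannZeta_eq_zero hz
  by_contra hc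
  push Not at hc
  set s : ℂ := β + t * I with hsdef
  have hre : s.re = β := by simp [hsdef]
  have him : s.im = t := by simp [hsdef]
  have hs1 : s ≠ 1 := by
    intro h
    have := congrArg Complex.im h
    rw [him] at this
    simp at this
    linarith
  have key := ZetaOneLine.riemannZeta₁_ne_zero_of_re_ge (s := s)
    (by rw [him, abs_of_pos ht0]; exact ht4)
    (by rw [him, hre, abs_of_pos ht0]; linarith) (by rw [hre]; linarith)
  exact key ((riemannZeta₁_eq_zero_iff hs1).2 hz)

/-- **The explicit a priori bound.** A zero `β + it` with `t ≥ exp 999` has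
`V(β, t) ≥ κ/(log t)⁸`, `κ = (27/164)/(0.1007 K)`, `K = 1134·16·336⁴`: from
`1 − β > 1/(2K log⁹ t)` (`one_sub_gt_titchmarsh`), `J(t) + 1.3686 ≥ (27/164) log t` and
`num(t) < 0.05035`. (Replaces the bound `V ≥ 0.5882` from Theorem 1.3 of `mtyV_ge`.)
[cite: Titchmarsh1986, §3.6 eq. (3.6.5)] -/
theorem mtyV_lower_explicit {β t : ℝ} (ht : Real.exp 999 ≤ t) (hz : riemannZeta (β + t * I) = 0) :
    27 / 164 / (0.1007 * (1134 * 16 * 336 ^ 4) * Real.log t ^ 8) ≤ mtyV β t := by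
  have hu := log_t_ge₆ ht
  have hβ := one_sub_gt_titchmarsh ht hz
  have hβ0 := one_sub_pos_of_riemannZeta_eq_zero hz
  have hJ' := mtyJ_add_ge t
  obtain ⟨hn1, hn2⟩ := mtyNum_mem ht
  have hn0 : 0 < mtyNum t := by linarith
  set K : ℝ := 1134 * 16 * 336 ^ 4 with hK
  have hK0 : 0 < K := by rw [hK]; norm_num
  set L := Real.log t with hL
  have hL0 : 0 < L := by linarith
  have hJ : 27 / 164 * L ≤ mtyJ t + 1.3686 := by linarith
  unfold mtyV
  rw [div_le_div_iff₀ (by positivity) hn0]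
  -- `(27/164) num ≤ (1 − β)(J + 1.3686) · 0.1007 K L⁸`
  have h1 : 1 / (2 * K * L ^ 9) * (27 / 164 * L) ≤ (1 - β) * (mtyJ t + 1.3686) :=
    mul_le_mul hβ.le hJ (by positivity) hβ0.le
  have h2 : 1 / (2 * K * L ^ 9) * (27 / 164 * L) * (2 * K * L ^ 8) = 27 / 164 := by
    field_simp
  have h3 : (27 / 164 : ℝ) ≤ (1 - β) * (mtyJ t + 1.3686) * (2 * K * L ^ 8) := by
    rw [← h2]
    exact mul_le_mul_of_nonneg_right h1 (by positivity)
  calc 27 / 164 * mtyNum t ≤ 27 / 164 * 0.05035 := by nlinarith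
    _ ≤ (1 - β) * (mtyJ t + 1.3686) * (2 * K * L ^ 8) * 0.05035 :=
        mul_le_mul_of_nonneg_right h3 (by norm_num)
    _ = (1 - β) * (mtyJ t + 1.3686) * (0.1007 * K * L ^ 8) := by ring

/-! ### Numerics of the descent -/

/-- `exp 1001 ≥ 10⁵⁰` (`exp 1 ≥ 2`, `2¹⁰⁰¹ ≥ 2¹⁷⁰ ≥ 10⁵⁰`). [folklore] -/
theorem exp_1001_ge_pow : (1e50 : ℝ) ≤ Real.exp 1001 := by
  have h1 : (2 : ℝ) ≤ Real.exp 1 := by linarith [Real.add_one_le_exp (1 : ℝ)]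
  have h2 : (2 : ℝ) ^ 1001 ≤ Real.exp 1 ^ 1001 := pow_le_pow_left₀ (by norm_num) h1 1001
  have h3 : Real.exp 1 ^ 1001 = Real.exp 1001 := by rw [← Real.exp_nat_mul]; norm_num
  have h4 : (1e50 : ℝ) ≤ (2 : ℝ) ^ 170 := by norm_num
  have h5 : (2 : ℝ) ^ 170 ≤ 2 ^ 1001 := pow_le_pow_right₀ (by norm_num) (by norm_num)
  exact h4.trans (h5.trans (h2.trans h3.le))

/-- `2.7 · exp 1000 ≤ exp 1001`. [folklore] -/
theorem exp_1000_le : 2.7 * Real.exp 1000 ≤ Real.exp 1001 := by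
  have h1 : Real.exp 1001 = Real.exp 1000 * Real.exp 1 := by rw [← Real.exp_add]; norm_num
  have h2 : (2.7 : ℝ) ≤ Real.exp 1 := by linarith [Real.exp_one_gt_d9]
  rw [h1, mul_comm]
  exact mul_le_mul_of_nonneg_left h2 (Real.exp_pos _).le

/-- `log 41 ≤ 4` (`41 ≤ 2.7⁴ ≤ e⁴`). [folklore] -/
theorem log_41_le : Real.log 41 ≤ 4 := by
  rw [Real.log_le_iff_le_exp (by norm_num)]
  have h2 : (2.7 : ℝ) ≤ Real.exp 1 := by linarith [Real.exp_one_gt_d9]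
  have h3 : (2.7 : ℝ) ^ 4 ≤ Real.exp 1 ^ 4 := pow_le_pow_left₀ (by norm_num) h2 4
  have h4 : Real.exp 1 ^ 4 = Real.exp 4 := by rw [← Real.exp_nat_mul]; norm_num
  have h5 : (41 : ℝ) ≤ (2.7 : ℝ) ^ 4 := by norm_num
  linarith

/-- `exp(5·10⁻⁶) ≤ 1 + 10⁻⁵`, i.e. `(1 + 10⁻⁵)^N ≥ exp(5·10⁻⁶ N)`. [folklore] -/
theorem exp_small_le : Real.exp 5e-6 ≤ 1 + 1e-5 := by
  have h := Real.abs_exp_sub_one_sub_id_le (x := 5e-6) (by rw [abs_le]; constructor <;> norm_num)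
  rw [abs_le] at h
  nlinarith [h.2]

/-- **The chain-length inequality of the descent.** For `t₀ ≥ exp 1001`, `t₀/2 ≤ N ≤ t₀` and
`0 < L ≤ log t₀ + 4N`: `κ (1 + 10⁻⁵)^N / L⁸ > 1`, `κ = (27/164)/(0.1007 K)`, `K = 1134·16·336⁴`
(`(1 + 10⁻⁵)^N ≥ exp(2.5·10⁻⁶ t₀) ≥ (2.5·10⁻⁶ t₀)¹⁰/10!`, `L ≤ 5t₀`, and `t₀ ≥ 10⁵⁰`). [folklore] -/
theorem chain_bound₆' {t₀ L : ℝ} {N : ℕ} (ht₀ : Real.exp 1001 ≤ t₀) (hN1 : (N : ℝ) ≤ t₀)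
    (hN2 : t₀ ≤ 2 * N) (hL0 : 0 < L) (hL : L ≤ Real.log t₀ + 4 * N) :
    1 < 27 / 164 / (0.1007 * (1134 * 16 * 336 ^ 4) * L ^ 8) * (1 + 1e-5) ^ N := by
  have ht50 : (1e50 : ℝ) ≤ t₀ := exp_1001_ge_pow.trans ht₀
  have ht0 : 0 < t₀ := by linarith
  set K : ℝ := 1134 * 16 * 336 ^ 4 with hK
  have hK0 : 0 < K := by rw [hK]; norm_num
  -- `L ≤ 5 t₀`
  have hlog : Real.log t₀ ≤ t₀ := by linarith [Real.log_le_sub_one_of_pos ht0]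
  have hL5 : L ≤ 5 * t₀ := by linarith
  have hL8 : L ^ 8 ≤ (5 * t₀) ^ 8 := pow_le_pow_left₀ hL0.le hL5 8
  -- `(1 + 10⁻⁵)^N ≥ exp(2.5e-6 t₀) ≥ (2.5e-6 t₀)^10 / 10!`
  have hpow : Real.exp (2.5e-6 * t₀) ≤ (1 + 1e-5) ^ N := by
    calc Real.exp (2.5e-6 * t₀) ≤ Real.exp (N * 5e-6) := Real.exp_le_exp.2 (by linarith)
      _ = Real.exp 5e-6 ^ N := Real.exp_nat_mul _ _
      _ ≤ (1 + 1e-5) ^ N := pow_le_pow_left₀ (Real.exp_pos _).le exp_small_le N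
  have hfac : (2.5e-6 * t₀) ^ 10 / 3628800 ≤ Real.exp (2.5e-6 * t₀) := by
    have := Real.pow_div_factorial_le_exp (x := 2.5e-6 * t₀) (by positivity) 10
    have h10 : ((Nat.factorial 10 : ℕ) : ℝ) = 3628800 := by norm_num [Nat.factorial]
    rwa [h10] at this
  -- the polynomial inequality
  have hpoly : 0.1007 * K * (5 * t₀) ^ 8 * 3628800 < 27 / 164 * (2.5e-6 * t₀) ^ 10 := by
    have hsq : (1e100 : ℝ) ≤ t₀ ^ 2 := by nlinarith
    have ht8 : 0 < t₀ ^ 8 := by positivity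
    calc 0.1007 * K * (5 * t₀) ^ 8 * 3628800 = (0.1007 * K * 5 ^ 8 * 3628800) * t₀ ^ 8 := by ring
      _ < (27 / 164 * 2.5e-6 ^ 10 * 1e100) * t₀ ^ 8 := by
          apply mul_lt_mul_of_pos_right _ ht8
          rw [hK]; norm_num
      _ ≤ (27 / 164 * 2.5e-6 ^ 10 * t₀ ^ 2) * t₀ ^ 8 := by
          apply mul_le_mul_of_nonneg_right _ ht8.le
          exact mul_le_mul_of_nonneg_left hsq (by norm_num)
      _ = 27 / 164 * (2.5e-6 * t₀) ^ 10 := by ring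
  -- assemble
  have hden : 0 < 0.1007 * K * L ^ 8 := by positivity
  have hden' : 0 < 0.1007 * K * (5 * t₀) ^ 8 := by positivity
  calc (1 : ℝ) < 27 / 164 * (2.5e-6 * t₀) ^ 10 / (0.1007 * K * (5 * t₀) ^ 8 * 3628800) := by
        rw [lt_div_iff₀ (by positivity), one_mul]; exact hpoly
    _ = 27 / 164 / (0.1007 * K * (5 * t₀) ^ 8) * ((2.5e-6 * t₀) ^ 10 / 3628800) := by
        field_simp
    _ ≤ 27 / 164 / (0.1007 * K * L ^ 8) * ((2.5e-6 * t₀) ^ 10 / 3628800) := by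
        apply mul_le_mul_of_nonneg_right _ (by positivity)
        apply div_le_div_of_nonneg_left (by norm_num) hden
        exact mul_le_mul_of_nonneg_left hL8 (by positivity)
    _ ≤ 27 / 164 / (0.1007 * K * L ^ 8) * (1 + 1e-5) ^ N := by
        apply mul_le_mul_of_nonneg_left (hfac.trans hpow) (by positivity)

/-! ### Window-minimal counterexamples for §6 without Theorem 1.3 -/

/-- **Existence of a window-minimal counterexample for §6, from Titchmarsh's explicit region.** If
some zero `β₀ + it₀` with `t₀ ≥ exp 1001` has `V(β₀, t₀) < 1`, then there is a zero `β + it` with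
`t ≥ exp 1000`, `V(β, t) < 1`, which is *window-minimal up to the factor `1 + 10⁻⁵`*: every zero
`β' + it'` with `t − 1 ≤ t' ≤ 40t + 1` has `(1 + 10⁻⁵) V(β', t') ≥ V(β, t)`. (A descending chain
`V(ρ_{k+1}) < V(ρ_k)/(1 + 10⁻⁵)`, `t_k − 1 ≤ t_{k+1} ≤ 40t_k + 1`, started at `ρ₀` and run for
`N = ⌊t₀ − exp 1000⌋` steps stays at heights `≥ exp 1000` and `≤ 41^N t₀`, so its last term has
`κ/(log t₀ + 4N)⁸ ≤ V(ρ_N) < (1 + 10⁻⁵)^{−N}` by `mtyV_lower_explicit`, contradicting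
`chain_bound₆'`. This is `exists_window_minimal_zero₆` with the a priori bound of Theorem 1.3
replaced by Titchmarsh's.) [cite: MossinghoffTrudgianYangRNT2024, §6 (choice of the zero with Y(β,t) = M)] -/
theorem exists_window_minimal_zero₆' {β₀ t₀ : ℝ} (ht₀ : Real.exp 1001 ≤ t₀)
    (hz₀ : riemannZeta (β₀ + t₀ * I) = 0) (hV₀ : mtyV β₀ t₀ < 1) :
    ∃ β t : ℝ, Real.exp 1000 ≤ t ∧ riemannZeta (β + t * I) = 0 ∧ mtyV β t < 1 ∧
      ∀ β' t' : ℝ, t - 1 ≤ t' → t' ≤ 40 * t + 1 → riemannZeta (β' + t' * I) = 0 →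
        mtyV β t ≤ (1 + 1e-5) * mtyV β' t' := by
  by_contra hcon
  push Not at hcon
  -- the successor map on counterexamples (no height condition on the successor)
  have hstep : ∀ p : ℝ × ℝ, (Real.exp 1000 ≤ p.2 ∧ riemannZeta (p.1 + p.2 * I) = 0 ∧
      mtyV p.1 p.2 < 1) → ∃ q : ℝ × ℝ, riemannZeta (q.1 + q.2 * I) = 0 ∧
        p.2 - 1 ≤ q.2 ∧ q.2 ≤ 40 * p.2 + 1 ∧ (1 + 1e-5) * mtyV q.1 q.2 < mtyV p.1 p.2 := by
    rintro ⟨β, t⟩ ⟨ht, hz, hV⟩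
    obtain ⟨β', t', h1, h2, hz', hlt⟩ := hcon β t ht hz hV
    exact ⟨(β', t'), hz', h1, h2, hlt⟩
  choose! F hF using hstep
  set s : ℕ → ℝ × ℝ := fun n ↦ F^[n] (β₀, t₀) with hsdef
  have he : Real.exp 999 ≤ Real.exp 1000 := Real.exp_le_exp.2 (by norm_num)
  have he1 : Real.exp 1000 ≤ t₀ := (Real.exp_le_exp.2 (by norm_num)).trans ht₀
  -- the number of steps
  set N : ℕ := ⌊t₀ - Real.exp 1000⌋₊ with hNdef
  have hN1 : (N : ℝ) ≤ t₀ - Real.exp 1000 := Nat.floor_le (by linarith)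
  have hN2 : t₀ - Real.exp 1000 < N + 1 := Nat.lt_floor_add_one _
  -- invariant along the first `N` steps
  have hinv : ∀ k : ℕ, k ≤ N → (t₀ - k ≤ (s k).2 ∧ (s k).2 ≤ 41 ^ k * t₀ ∧
      riemannZeta ((s k).1 + (s k).2 * I) = 0 ∧
      mtyV (s k).1 (s k).2 * (1 + 1e-5) ^ k ≤ mtyV β₀ t₀) := by
    intro k
    induction k with
    | zero => intro _; simp [hsdef, hz₀]
    | succ k ih =>
      intro hk
      obtain ⟨h1, h1', h2, h3⟩ := ih (Nat.le_of_succ_le hk)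
      have hkN : (k : ℝ) + 1 ≤ N := by exact_mod_cast hk
      have htk : Real.exp 1000 ≤ (s k).2 := by linarith
      have hVk : mtyV (s k).1 (s k).2 < 1 := by
        have hp : 1 ≤ (1 + 1e-5 : ℝ) ^ k := one_le_pow₀ (by norm_num)
        have hV0 : 0 ≤ mtyV (s k).1 (s k).2 := (mtyV_pos (he.trans htk) h2).le
        nlinarith
      obtain ⟨hz', ht', ht'', hlt⟩ := hF (s k) ⟨htk, h2, hVk⟩
      have hs' : s (k + 1) = F (s k) := by simp only [hsdef, Function.iterate_succ_apply']
      rw [hs']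
      refine ⟨by push_cast; linarith, ?_, hz', ?_⟩
      · have hk1 : (1 : ℝ) ≤ (s k).2 := le_trans (by linarith [Real.add_one_le_exp (1000 : ℝ)]) htk
        calc (F (s k)).2 ≤ 40 * (s k).2 + 1 := ht''
          _ ≤ 41 * (s k).2 := by linarith
          _ ≤ 41 * (41 ^ k * t₀) := by linarith
          _ = 41 ^ (k + 1) * t₀ := by ring
      · have hpow : 0 ≤ (1 + 1e-5 : ℝ) ^ k := by positivity
        calc mtyV (F (s k)).1 (F (s k)).2 * (1 + 1e-5) ^ (k + 1)
            = ((1 + 1e-5) * mtyV (F (s k)).1 (F (s k)).2) * (1 + 1e-5) ^ k := by ring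
          _ ≤ mtyV (s k).1 (s k).2 * (1 + 1e-5) ^ k := mul_le_mul_of_nonneg_right hlt.le hpow
          _ ≤ _ := h3
  -- at `k = N`
  obtain ⟨h1, h1', h2, h3⟩ := hinv N le_rfl
  have htN : Real.exp 1000 ≤ (s N).2 := by linarith
  have htN' : Real.exp 999 ≤ (s N).2 := he.trans htN
  have ht0 : 0 < t₀ := (Real.exp_pos _).trans_le he1
  have htN0 : 0 < (s N).2 := (Real.exp_pos _).trans_le htN
  have hVN := mtyV_lower_explicit htN' h2
  -- `log t_N ≤ log t₀ + 4N`
  have hlogN : Real.log (s N).2 ≤ Real.log t₀ + 4 * N := by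
    calc Real.log (s N).2 ≤ Real.log (41 ^ N * t₀) := Real.log_le_log htN0 h1'
      _ = N * Real.log 41 + Real.log t₀ := by
          rw [Real.log_mul (by positivity) ht0.ne', Real.log_pow]
      _ ≤ Real.log t₀ + 4 * N := by
          have := mul_le_mul_of_nonneg_left log_41_le (Nat.cast_nonneg N); linarith
  have hLN0 : 0 < Real.log (s N).2 := by have := log_t_ge₆ htN'; linarith
  -- `N ≥ t₀/2`, `N ≤ t₀`
  have hNle : (N : ℝ) ≤ t₀ := by linarith [Real.exp_pos (1000 : ℝ)]
  have hNge : t₀ ≤ 2 * N := by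
    have h50 : (1e50 : ℝ) ≤ t₀ := exp_1001_ge_pow.trans ht₀
    have h27 : 2.7 * Real.exp 1000 ≤ t₀ := exp_1000_le.trans ht₀
    linarith
  have hcb := chain_bound₆' ht₀ hNle hNge hLN0 hlogN
  -- `κ/(log t_N)⁸ (1 + δ)^N ≤ V_N (1 + δ)^N ≤ V₀ < 1`
  have hpow : 0 ≤ (1 + 1e-5 : ℝ) ^ N := by positivity
  have := mul_le_mul_of_nonneg_right hVN hpow
  linarith

/-! ### The terminal zero without Theorem 1.3 -/

/-- **The zero-free rectangle of a window-minimal counterexample** (`zetaZeroFreeRect₆` with the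
a priori bound of Theorem 1.3 replaced by `V > 0`): if `V(β, t) ≤ (1 + 10⁻⁵) V(β', t')` for all zeros
`β' + it'` with `t − 1 ≤ t' ≤ 40t + 1` (`t ≥ exp 1000`), then with
`λ = V(β, t) · num(t − 1)/((1 + 10⁻⁵)(J(40t + 1) + 1.3686))` there are no zeros in
`1 − λ < Re s ≤ 1`, `t − 1 ≤ Im s ≤ 40t + 1`.
[cite: MossinghoffTrudgianYangRNT2024, §6 (the zero-free region (6.2) at the extremal zero)] -/
theorem zetaZeroFreeRect₆' {β t : ℝ} (ht : Real.exp 1000 ≤ t)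
    (hmin : ∀ β' t' : ℝ, t - 1 ≤ t' → t' ≤ 40 * t + 1 → riemannZeta (β' + t' * I) = 0 →
        mtyV β t ≤ (1 + 1e-5) * mtyV β' t') :
    ZetaZeroFreeRect (mtyV β t * mtyNum (t - 1) / ((1 + 1e-5) * (mtyJ (40 * t + 1) + 1.3686)))
      t (40 * t + 1) := by
  have ht' : Real.exp 999 ≤ t := (Real.exp_le_exp.2 (by norm_num)).trans ht
  have ht1 : Real.exp 999 ≤ t - 1 := exp_999_le.trans (by linarith)
  have hn1 := mtyNum_pos ht1
  have ht0 : 0 < t := (Real.exp_pos _).trans_le ht'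
  have hD := mtyJ_add_ge' (ht'.trans (by linarith : t ≤ 40 * t + 1))
  intro s h1 h2 h3 h4 hs
  have hs' : riemannZeta (s.re + s.im * I) = 0 := by rwa [Complex.re_add_im]
  have hsim : Real.exp 999 ≤ s.im := ht1.trans h3
  have hm := hmin s.re s.im h3 h4 hs'
  have hVs0 : 0 < mtyV s.re s.im := mtyV_pos hsim hs'
  have hβs := one_sub_eq_mtyV (β := s.re) hsim
  have hJs : mtyJ s.im + 1.3686 ≤ mtyJ (40 * t + 1) + 1.3686 := by
    have := mtyJ_mono ((Real.exp_pos _).trans_le hsim) h4; linarith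
  have hJs0 := mtyJ_add_ge' hsim
  have hns : mtyNum (t - 1) ≤ mtyNum s.im := mtyNum_mono ht1 h3
  have key : mtyV β t * mtyNum (t - 1) / ((1 + 1e-5) * (mtyJ (40 * t + 1) + 1.3686)) ≤ 1 - s.re := by
    rw [hβs, div_le_div_iff₀ (by positivity) (by linarith)]
    have e1 : mtyV β t * mtyNum (t - 1) ≤ (1 + 1e-5) * mtyV s.re s.im * mtyNum s.im :=
      mul_le_mul hm hns hn1.le (by positivity)
    calc mtyV β t * mtyNum (t - 1) * (mtyJ s.im + 1.3686)
        ≤ ((1 + 1e-5) * mtyV s.re s.im * mtyNum s.im) * (mtyJ (40 * t + 1) + 1.3686) :=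
          mul_le_mul e1 hJs (by linarith)
            (mul_nonneg (mul_nonneg (by norm_num) hVs0.le) (mtyNum_pos hsim).le)
      _ = _ := by ring
  linarith

/-- **The terminal step of §6 from Lemma 6.1 alone** (`terminal₆` with the a priori bound of
Theorem 1.3 replaced by `V > 0`; the proof is otherwise verbatim): a zero `β + it`, `t ≥ exp 1000`,
with `V(β, t) < 1` cannot be window-minimal up to the factor `1 + 10⁻⁵`. With `λ` as in
`zetaZeroFreeRect₆'`, Lemma 6.1 applies (`λ ≤ 1 − β`, `β ≥ 1 − 1/1712`); its left side is at least
`λ⁻¹ b · num(t − 1) = (1 + 10⁻⁵) b (J(40t + 1) + 1.3686)/V > b (J(40t + 1) + 1.3686)` by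
`key_ineq₆`, and `endgame₆` finishes. [cite: MossinghoffTrudgianYangRNT2024, §6 (proof of Theorem 1.4)] -/
theorem terminal₆' (hZ6 : zero_inequality_intermediate_mossinghoff_trudgian_yang)
    {β t : ℝ} (ht : Real.exp 1000 ≤ t) (hz : riemannZeta (β + t * I) = 0)
    (hV : mtyV β t < 1)
    (hmin : ∀ β' t' : ℝ, t - 1 ≤ t' → t' ≤ 40 * t + 1 → riemannZeta (β' + t' * I) = 0 →
        mtyV β t ≤ (1 + 1e-5) * mtyV β' t') : False := by
  -- the setting at the terminal zero
  have ht' : Real.exp 999 ≤ t := (Real.exp_le_exp.2 (by norm_num)).trans ht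
  have ht1 : Real.exp 999 ≤ t - 1 := exp_999_le.trans (by linarith)
  have ht0 : 0 < t := (Real.exp_pos _).trans_le ht'
  have hu : 1000 ≤ Real.log t := by rw [Real.le_log_iff_exp_le ht0]; exact ht
  have hJt := mtyJ_add_ge t
  have hJt' : 171.72 ≤ mtyJ t + 1.3686 := by linarith
  have h40 : t ≤ 40 * t + 1 := by linarith
  have hD := mtyJ_add_ge' (ht'.trans h40)
  have hJ40 := mtyJ_40t_le ht'
  have hn1 := mtyNum_pos ht1
  obtain ⟨hn0a, hn0b⟩ := mtyNum_mem ht'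
  have hn00 : 0 ≤ mtyNum t := by linarith
  have hn01 := mtyNum_le_succ ht
  have hn10 : mtyNum (t - 1) ≤ mtyNum t := mtyNum_mono ht1 (by linarith)
  have hV0 : 0 < mtyV β t := mtyV_pos ht' hz
  have hβ := one_sub_eq_mtyV (β := β) ht'
  obtain ⟨hc0, hc1⟩ := mtyC6_mem ht'
  -- the coefficients of `P₄₀`
  have hbnear := mtyB40_sum_near
  rw [abs_le] at hbnear
  have hblo : 3.564539654371339 ≤ mtyB40Sum := by unfold mtyB40Sum; linarith [hbnear.1]
  have hbhi : mtyB40Sum ≤ 3.564539654371341 := by unfold mtyB40Sum; linarith [hbnear.2]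
  -- λ and `D = J(40t + 1) + 1.3686`
  have hrect := zetaZeroFreeRect₆' ht hmin
  set D := mtyJ (40 * t + 1) + 1.3686 with hDdef
  set lam := mtyV β t * mtyNum (t - 1) / ((1 + 1e-5) * D) with hlamdef
  have hD0 : 0 < D := by linarith
  have hlam0 : 0 < lam := by positivity
  have hDJ : mtyJ t + 1.3686 ≤ D := by have := mtyJ_mono ht0 h40; rw [hDdef]; linarith
  have hlamβ : lam ≤ 1 - β := by
    rw [hβ, hlamdef, div_le_div_iff₀ (by positivity) (by positivity)]
    calc mtyV β t * mtyNum (t - 1) * (mtyJ t + 1.3686)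
        = mtyV β t * (mtyNum (t - 1) * (mtyJ t + 1.3686)) := by ring
      _ ≤ mtyV β t * (mtyNum t * ((1 + 1e-5) * D)) := by
          apply mul_le_mul_of_nonneg_left _ hV0.le
          exact mul_le_mul hn10 (by linarith) (by linarith) hn00
      _ = _ := by ring
  -- `1 − β ≤ 0.05035 c(t)`, hence `β ≥ 1 − 1/1712`
  have hw : 1 - β ≤ 0.05035 * mtyC6 t := by
    rw [hβ]; unfold mtyC6
    rw [div_eq_mul_one_div]
    have hVn : mtyV β t * mtyNum t ≤ 0.05035 := by
      have := mul_le_mul hV.le hn0b.le hn00 (by norm_num); linarith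
    exact mul_le_mul_of_nonneg_right hVn (by positivity)
  have hβ1712 : 1 - 1 / 1712 ≤ β := by
    have hc3 : mtyC6 t ≤ 1 / 171.72 := by
      unfold mtyC6; exact one_div_le_one_div_of_le (by norm_num) hJt'
    have h2 : 0.05035 * mtyC6 t ≤ 1 / 1712 := by linarith
    linarith
  -- `X + 1 = (1 − β)/λ ≤ (1 + δ)(1 + 0.6073156 c)(1 + 10⁻⁹)` and the key inequality
  have hXeq : (1 - β) / lam
      = (1 + 1e-5) * (D / (mtyJ t + 1.3686)) * (mtyNum t / mtyNum (t - 1)) := by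
    rw [hβ, hlamdef]
    field_simp
  have hX : (1 - β) / lam - 1 + 1 ≤ (1 + 1e-5) * (1 + 0.6073156 * mtyC6 t) * (1 + 1e-9) := by
    rw [sub_add_cancel, hXeq]
    have e1 : D / (mtyJ t + 1.3686) ≤ 1 + 0.6073156 * mtyC6 t := by
      unfold mtyC6
      rw [div_le_iff₀ (by linarith)]
      have : (1 + 0.6073156 * (1 / (mtyJ t + 1.3686))) * (mtyJ t + 1.3686)
          = mtyJ t + 1.3686 + 0.6073156 := by field_simp
      rw [this, hDdef]; linarith
    have e2 : mtyNum t / mtyNum (t - 1) ≤ 1 + 1e-9 := by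
      rw [div_le_iff₀ hn1]; linarith
    exact mul_le_mul (mul_le_mul_of_nonneg_left e1 (by norm_num)) e2 (by positivity) (by positivity)
  have hn1le : mtyNum (t - 1) ≤ 0.05035 - 0.0349 * mtyC6 t := by
    have := hn10; unfold mtyNum at this ⊢; linarith
  have hK := key_ineq₆ hX hc0.le hbhi hn1.le hn1le
  -- the left side of Lemma 6.1 is `≥ λ⁻¹ b n₁ = (1 + δ) D b / V > D b`
  have hL : (1 + 1e-5) * D * mtyB40Sum / mtyV β t
      ≤ 1 / lam * (0.17949 - 0.20466 * ((1 - β) / lam - 1)) := by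
    have e : (1 + 1e-5) * D * mtyB40Sum / mtyV β t = 1 / lam * (mtyB40Sum * mtyNum (t - 1)) := by
      rw [hlamdef]; field_simp
    rw [e]
    exact mul_le_mul_of_nonneg_left hK (by positivity)
  have hDb : 0 < D * mtyB40Sum := mul_pos hD0 (by linarith)
  have hL2 : D * mtyB40Sum < (1 + 1e-5) * D * mtyB40Sum / mtyV β t := by
    rw [lt_div_iff₀ hV0]
    calc D * mtyB40Sum * mtyV β t < D * mtyB40Sum * 1 := mul_lt_mul_of_pos_left hV hDb
      _ ≤ (1 + 1e-5) * D * mtyB40Sum := by linarith only [hDb]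
  -- Lemma 6.1
  have main := hZ6 β t ht hz hβ1712 lam hlam0 hlamβ hrect
  rw [mtyB40_zero, div_one] at main
  have hfin := hL2.trans_le (hL.trans main)
  clear main hL hL2 hrect hmin hXeq hX hK
  -- hfin : D b < 5.746(1−β) + b J(40t+1) + 0.851 + 1.0146 λ b S, with D = J(40t+1) + 1.3686
  have h1 : 1.3686 * mtyB40Sum < 5.746 * (1 - β) + 0.851 + 1.0146 * lam * mtyB40Sum
      * (3.5691 * Real.log (40 * t + 1) + 5.316 * Real.log (Real.log (40 * t + 1)) + 18.439) := by
    have e : D * mtyB40Sum = mtyB40Sum * mtyJ (40 * t + 1) + 1.3686 * mtyB40Sum := by rw [hDdef]; ring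
    rw [e] at hfin
    linarith only [hfin]
  exact endgame₆ ht (hlamβ.trans hw) hw hblo hbhi h1

/-- **The bound of §6, proved from Lemma 6.1 alone**: every zero `β + it` of `ζ` with `t ≥ exp 1001`
satisfies `V(β, t) ≥ 1`, i.e. `1 − β ≥ c(t)(0.05035 − 0.0349 c(t))`, `c(t) = 1/(J(t) + 1.3686)`
(`one_le_mtyV` without the hypothesis Theorem 1.3: the descent of `exists_window_minimal_zero₆'`
and the terminal step `terminal₆'`). [cite: MossinghoffTrudgianYangRNT2024, §6 (proof of Theorem 1.4)] -/
theorem one_le_mtyV' (hZ6 : zero_inequality_intermediate_mossinghoff_trudgian_yang) :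
    ∀ β t : ℝ, Real.exp 1001 ≤ t → riemannZeta (β + t * I) = 0 → 1 ≤ mtyV β t := by
  intro β₀ t₀ ht₀ hz₀
  by_contra hV₀
  push Not at hV₀
  obtain ⟨β, t, ht, hz, hV, hmin⟩ := exists_window_minimal_zero₆' ht₀ hz₀ hV₀
  exact terminal₆' hZ6 ht hz hV hmin

/-- From the bound `V ≥ 1` for zeros of height `≥ exp 1001` to the intermediate region for
`|t| ≥ exp 1001` (the last step of the proof of `zero_free_region_intermediate_of_zero_inequality`,
isolated: negative `t` by `ζ(s̄) = conj ζ(s)`, then `1 − σ ≥ c(t)(0.05035 − 0.0349 c(t)) ≥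
0.05035/h − 0.0349/h²` by `J(t) + 1.3686 ≤ h` and the monotonicity of `x ↦ 0.05035x − 0.0349x²`).
[cite: MossinghoffTrudgianYangRNT2024, Theorem 1.4 and §6] -/
theorem intermediate_of_one_le_mtyV
    (hV1 : ∀ β t : ℝ, Real.exp 1001 ≤ t → riemannZeta (β + t * I) = 0 → 1 ≤ mtyV β t) :
    ∀ σ t : ℝ, Real.exp 1001 ≤ |t| →
      1 - 0.05035 / (27 / 164 * Real.log |t| + 7.096)
        + 0.0349 / (27 / 164 * Real.log |t| + 7.096) ^ 2 < σ →
      riemannZeta (σ + t * I) ≠ 0 := by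
  intro σ t ht hσ
  -- reduce to `0 < t` by the conjugation symmetry of `ζ`
  wlog h0 : 0 < t generalizing t
  · have ht0 : t < 0 := by
      rcases lt_trichotomy t 0 with h | h | h
      · exact h
      · subst h; rw [abs_zero] at ht; linarith [Real.exp_pos (1001 : ℝ)]
      · exact absurd h h0
    have key := this (-t) (by simpa using ht) (by simpa using hσ) (by linarith)
    intro hz
    apply key
    have hconj : (σ : ℂ) + ((-t : ℝ) : ℂ) * I = starRingEnd ℂ ((σ : ℂ) + (t : ℂ) * I) := by
      apply Complex.ext <;> simp
    rw [hconj, riemannZeta_conj, hz, map_zero]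
  rw [abs_of_pos h0] at ht hσ
  intro hz
  have hV := hV1 σ t ht hz
  have ht' : Real.exp 999 ≤ t := (Real.exp_le_exp.2 (by norm_num)).trans ht
  have hJ1 := mtyJ_add_ge' ht'
  have hJ2 := mtyJ_add_le t
  have hn := mtyNum_pos ht'
  obtain ⟨hc0, hc1⟩ := mtyC6_mem ht'
  have hD0 : 0 < mtyJ t + 1.3686 := by linarith
  have hh0 : 0 < 27 / 164 * Real.log t + 7.096 := by linarith
  -- `1 − σ ≥ num(t)/(J(t) + 1.3686) = 0.05035 c − 0.0349 c²`
  have h1 : mtyNum t / (mtyJ t + 1.3686) ≤ 1 - σ := by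
    unfold mtyV at hV
    rw [le_div_iff₀ hn] at hV
    rw [div_le_iff₀ hD0]
    linarith
  have e2 : mtyNum t / (mtyJ t + 1.3686) = 0.05035 * mtyC6 t - 0.0349 * mtyC6 t ^ 2 := by
    unfold mtyNum mtyC6
    field_simp
  -- `1/h ≤ c(t)` and monotonicity of `x ↦ 0.05035x − 0.0349x²` on `[0, 0.72]`
  have hxc : 1 / (27 / 164 * Real.log t + 7.096) ≤ mtyC6 t := by
    unfold mtyC6; exact one_div_le_one_div_of_le hD0 hJ2
  have hx0 : 0 ≤ 1 / (27 / 164 * Real.log t + 7.096) := by positivity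
  have e1 : 0.05035 / (27 / 164 * Real.log t + 7.096) - 0.0349 / (27 / 164 * Real.log t + 7.096) ^ 2
      = 0.05035 * (1 / (27 / 164 * Real.log t + 7.096))
        - 0.0349 * (1 / (27 / 164 * Real.log t + 7.096)) ^ 2 := by
    field_simp
  have key : 0.05035 * (1 / (27 / 164 * Real.log t + 7.096))
        - 0.0349 * (1 / (27 / 164 * Real.log t + 7.096)) ^ 2
      ≤ 0.05035 * mtyC6 t - 0.0349 * mtyC6 t ^ 2 := by
    have hprod := mul_nonneg (sub_nonneg.2 hxc)
      (show (0 : ℝ) ≤ 0.05035 - 0.0349 * (mtyC6 t + 1 / (27 / 164 * Real.log t + 7.096)) by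
        linarith)
    nlinarith [hprod]
  linarith [h1, e1, e2, key, hσ]

/-- **Theorem 1.4 from height `exp 7000`, from Lemma 6.1 alone** (`intermediateRegionFrom_exp_7000_of_zero_inequality`
without the hypothesis Theorem 1.3). [cite: MossinghoffTrudgianYangRNT2024, Theorem 1.4 and §6] -/
theorem intermediateRegionFrom_exp_7000_of_zero_inequality'
    (hZ6 : zero_inequality_intermediate_mossinghoff_trudgian_yang) :
    IntermediateRegionFrom (Real.exp 7000) :=
  fun σ t ht hσ ↦ intermediate_of_one_le_mtyV (one_le_mtyV' hZ6) σ t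
    ((Real.exp_le_exp.2 (by norm_num)).trans ht) hσ

end VK

open VK in
/-- **Theorem 1.4 of Mossinghoff–Trudgian–Yang for `|t| ≥ exp 1001`, proved from Lemma 6.1 alone.**
For `|t| ≥ exp 1001` and `σ > 1 − 0.05035/h + 0.0349/h²`, `h = (27/164) log|t| + 7.096`,
`ζ(σ + it) ≠ 0`. This is `zero_free_region_intermediate_of_zero_inequality` with its hypothesis
Theorem 1.3 (`zero_free_region_mossinghoff_trudgian_yang`) removed: the a priori bound that made
the descent of §6 finite is taken instead from Titchmarsh's explicit region (3.6.5), proved in the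
tree (`VK.mtyV_lower_explicit`, `VK.exists_window_minimal_zero₆'`). The printed theorem starts at
`exp 1000`; the threshold `exp 1001` leaves room for the descent above the threshold `exp 1000` of
Lemma 6.1. [cite: MossinghoffTrudgianYangRNT2024, Theorem 1.4 and §6] -/
theorem zero_free_region_intermediate_of_zero_inequality'
    (hZ6 : zero_inequality_intermediate_mossinghoff_trudgian_yang) :
    ∀ σ t : ℝ, Real.exp 1001 ≤ |t| →
      1 - 0.05035 / (27 / 164 * Real.log |t| + 7.096)
        + 0.0349 / (27 / 164 * Real.log |t| + 7.096) ^ 2 < σ →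
      riemannZeta (σ + t * I) ≠ 0 :=
  intermediate_of_one_le_mtyV (one_le_mtyV' hZ6)

open VK in
/-- **The large-height bound of §5 of Mossinghoff–Trudgian–Yang from three analytic inputs.** Ford's
bound (3.1) (`zeta_bound_ford`), Lemma 4.7 (`zero_inequality_mossinghoff_trudgian_yang`) and Lemma 6.1
(`zero_inequality_intermediate_mossinghoff_trudgian_yang`) imply that every zero `β + it` of `ζ` with
`t ≥ exp 52238` has `(1 − β) · 4.45^{2/3} (log t)^{2/3} (log log t)^{1/3} ≥ 0.048976`
(`zero_bound_large_height_mossinghoff_trudgian_yang`): Theorem 1.4 from `exp 7000` by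
`VK.intermediateRegionFrom_exp_7000_of_zero_inequality'`, then
`VK.zero_bound_large_height_of_zero_inequality'`. Compared with `zero_bound_large_height_of_inputs`,
the hypothesis Theorem 1.3 (and with it the numerical verification of RH to height `3·10¹²`) is gone.
[cite: MossinghoffTrudgianYangRNT2024, §5 (proof of Theorem 1.1 for t ≥ T₀)] -/
theorem zero_bound_large_height_of_inputs' (hF : zeta_bound_ford)
    (hZ47 : zero_inequality_mossinghoff_trudgian_yang)
    (hZ6 : zero_inequality_intermediate_mossinghoff_trudgian_yang) :
    zero_bound_large_height_mossinghoff_trudgian_yang :=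
  zero_bound_large_height_of_zero_inequality' hF
    (intermediateRegionFrom_exp_7000_of_zero_inequality' hZ6) hZ47

end Literature.NumberTheory.LFunctions
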